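import Literature.NumberTheory.Automorphic.SymplecticSimilitudeSatakeWeylInvariance
import Literature.NumberTheory.Automorphic.SymplecticSatakeIsomorphism
import HarnessLib

/-!
# The Satake isomorphism for `GSp_{2n}` in every rank: `𝒮_q : ℋ(GSp_{2n}(K), GSp_{2n}(𝒪); R) ⥲ R[ℤⁿ × ℤ]^{W(GSp_{2n})}` for
# every commutative ring `R` in which the residue cardinality `q` is a unit (Andrianov–Zhuravlev Ch. 3 Thm. 3.30 (3);
# Satake 1963 §7; Cartier 1979 §IV Thm. 4.1)

Topic `NumberTheory/Automorphic`; namespace `Literature.NumberTheory.Automorphic.SymplecticCartan` (lane `lit-hodgefound`,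
Track 2 foundations; seat `lit-hodgefound-p11`, generation 51, row g51-#4).  DEFINITIONS with bodies (`similitudeDominantBelow`,
`similitudeSatakeAlgEquiv`) + theorems; no named fact, no instance, no notation.  Assembles `SymplecticSimilitudeSatakeWeylInvariance`
(g51-#2: `𝒮_q(ℋ_R) ⊆ R[ℤⁿ × ℤ]^W`), the tree's injectivity over every commutative ring
(`similitudeSatakeTransform_injective_of_commRing`), its triangularity (`headSum_le_of_coeff_similitudeSatakeTransform_ne_zero`,
`snd_eq_of_coeff_similitudeSatakeTransform_ne_zero`) and its unit leading coefficient (`coeff_self_similitudeSatakeTransform_torusElt`: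
the coefficient of `x^{(m + a, m)}` in `𝒮_q(T_{t(m,a)})` is `q^{⟨ρ, m + a⟩}`) — the `GSp_{2n}` twin of `SymplecticSatakeIsomorphism`
(g50-#6).  The tree's `SymplecticSimilitudeHeckeAlgebraStructure` said «Not formalised here: the identification of the image of the
Satake transform with the Weyl-group invariants»; this file supplies it.

## The mathematics

`G = GSp(J, K)`, `K₀ = GSp(J, 𝒪)` (compact `𝒪`, `q = #𝓀`), `W = W(GSp_{2n}) = (ℤ/2)^n ⋊ S_n` acting on `X_*(S) = ℤⁿ × ℤ` by
`(μ, c) ↦ ((μ_{π i} | c - μ_{π i})_i, c)`.  The `W`-orbits in the slice `c` are represented by the DOMINANT exponents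
`μ_0 ≥ μ_1 ≥ ⋯ ≥ μ_{n-1}`, `2μ_{n-1} ≥ c` — exactly the exponents `(m + a, m)` of the Cartan representatives `t(m, a)` (`a` antitone,
`m + 2aᵢ ≥ 0`; `m = c`, `a = μ - c·1`).  THEOREM ([AndrianovZhuravlev1995] Ch. 3 Thm. 3.30 (3) «the restriction of `Ω` to `L^n_p` is
an isomorphism of this ring with `ℚ[x_0^{±1}, …, x_n^{±1}]_W`»; [Satake1963] §7; [CartierCorvallis1979] Thm. 4.1 «the Satake
transform is an isomorphism of `H(G, K)` onto `ℂ[X_*(A)]^W`»): for every commutative ring `R` and unit `q ∈ Rˣ` equal to the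
residue cardinality, **`𝒮_q : ℋ_R(G, K₀) ⥲ R[ℤⁿ × ℤ]^W` is an isomorphism of `R`-algebras** (`similitudeSatakeAlgEquiv`; e.g.
`R = ℤ[1/q]`, `𝔽_ℓ` with `ℓ ∤ q`, `ℚ`, `ℂ`).  PROOF of surjectivity (Cartier's (c), as in g50-#6 but slice by slice in `c`): for
`0 ≠ f ∈ R[ℤⁿ × ℤ]^W` pick `(a, c) ∈ supp f` with `a` head-sum-maximal in the slice `S_c = {μ : f_{(μ,c)} ≠ 0}`; `S_c` is
stable under `W` acting on the slice, so `a` is dominant (a transposition at an ascent, or `τ_k` at a coordinate with `2a_k < c`,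
would increase the head-sum vector); `F = 𝒮_q(T_{t(c, a - c·1)}) ∈ R[ℤⁿ × ℤ]^W` has `F_{(a,c)} = q^{⟨ρ,a⟩} ∈ Rˣ` and is supported
on `{(μ, c) : μ ≤_dom a}`; `g = f - (f_{(a,c)}/F_{(a,c)}) F` is `W`-invariant with `g_{(a,c)} = 0` and the finite set
`U(g) ⊊ U(f)` of dominant exponents below a dominant exponent of the support (same slice) strictly decreases; induct.

## What is formalised

* §1 **`antitone_two_mul_ge_of_isMaxOn_headSumVec`** (a head-sum maximal element of a `W`-stable slice is dominant).
* §2 `finite_setOf_antitone_two_mul_ge_headSum_le`, **`similitudeDominantBelow f`** (`U(f)`), `finite_similitudeDominantBelow`.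
* §3 **`exists_similitudeSatakeTransform_eq`** (SURJECTIVITY onto `R[ℤⁿ × ℤ]^W`),
  **`range_similitudeSatakeTransform_eq_weylInvariants`**,
  **`similitudeSatakeAlgEquiv : ℋ_R(GSp_{2n}(K), GSp_{2n}(𝒪)) ≃ₐ[R] R[ℤⁿ × ℤ]^{W(GSp_{2n})}`**, `coe_similitudeSatakeAlgEquiv`,
  `similitudeSatakeAlgEquiv_symm_apply_similitudeSatakeTransform`, `existsUnique_similitudeSatakeTransform_eq`
  (A–Z (3.77): `q_i = Ω(𝐪_i)` for uniquely determined `𝐪_i`).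

## References
* [AndrianovZhuravlev1995] A. N. Andrianov, V. G. Zhuravlev, *Modular Forms and Hecke Operators*, Transl. Math. Monogr. 145
  (1995), Ch. 3 §3.3 (3.51), Thm. 3.30 and its proof, (3.77).
* [Satake1963] I. Satake, *Theory of spherical functions on reductive algebraic groups over 𝔭-adic fields*, Publ. Math. IHÉS 18
  (1963), §6 Thm. 7, §7.
* [CartierCorvallis1979] P. Cartier, *Representations of 𝔭-adic groups: a survey*, PSPM 33.1 (1979), §IV (4.2), Thm. 4.1 and its
  proof (b), (c); §IV.4.
* [GrossSatake1998] B. H. Gross, *On the Satake isomorphism* (1998), §3 (integrality: `ℤ[q⁻¹]` when `δ^{1/2}` is `q^ℤ`-valued).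
* [BruhatTits1972] F. Bruhat, J. Tits, *Groupes réductifs sur un corps local I*, Publ. Math. IHÉS 41 (1972), Prop. (4.4.4).
-/

noncomputable section

open scoped Valued WithZero MatrixGroups
open Matrix MonoidAlgebra Representation MulAction

namespace Literature.NumberTheory.Automorphic.SymplecticCartan

open Literature.NumberTheory.Automorphic Literature.NumberTheory.Automorphic.CartanUnique
  Literature.NumberTheory.Automorphic.HermitianLattice

variable {n : ℕ}

/-! ## §1 Dominant exponents of `GSp_{2n}`: a head-sum maximal element of a `W`-stable slice is dominant -/

/-- **A head-sum lexicographically maximal element of a `W(GSp_{2n})`-stable finite set of exponents with multiplier `c` is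
DOMINANT**: `a` antitone and `2 a_i ≥ c` for all `i` (a transposition at an ascent, or `τ_k` at a coordinate with `2a_k < c`,
would increase the head-sum vector). [cite: CartierCorvallis1979, §IV, proof of Thm. 4.1 (c)] [cite: BruhatTits1972, Prop. (4.4.4)]
[cite: AndrianovZhuravlev1995, Ch. 3 §3.3 (3.51)] -/
theorem antitone_two_mul_ge_of_isMaxOn_headSumVec {S : Finset (Fin n → ℤ)} {c : ℤ}
    (hS : ∀ μ ∈ S, ∀ (ε : Fin n → ℤˣ) (π : Equiv.Perm (Fin n)), (similitudeSignedPermEquiv ε π (μ, c)).1 ∈ S)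
    {a : Fin n → ℤ} (ha : a ∈ S) (hmax : ∀ b ∈ S, toLex (headSumVec b) ≤ toLex (headSumVec a)) :
    Antitone a ∧ ∀ i, c ≤ 2 * a i := by
  constructor
  · -- antitone: otherwise swap an ascent `a i < a j`, `i < j`
    intro i j hij
    by_contra hcon
    rw [not_le] at hcon
    have hne : i ≠ j := fun h => by rw [h] at hcon; exact lt_irrefl _ hcon
    have hlt : (i : ℕ) < (j : ℕ) := lt_of_le_of_ne (Fin.le_iff_val_le_val.1 hij) fun h => hne (Fin.ext h)
    have hb := hS a ha (fun _ => 1) (Equiv.swap i j)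
    have hb' : (similitudeSignedPermEquiv (fun _ => (1 : ℤˣ)) (Equiv.swap i j) (a, c)).1 = a ∘ Equiv.swap i j := by
      funext k; rw [similitudeSignedPermEquiv_apply]; dsimp only; rw [if_pos rfl, Function.comp_apply]
    rw [hb'] at hb
    refine absurd (hmax _ hb) (not_le.2 (toLex_headSumVec_lt i (fun r hr => ?_) ?_))
    · exact (headSum_comp_eq_of_forall_lt a _ r fun k hk =>
        Equiv.swap_apply_of_ne_of_ne (fun h => by rw [h] at hk; omega) (fun h => by rw [h] at hk; omega)).symm
    · rw [headSum_succ, headSum_succ, headSum_comp_eq_of_forall_lt a _ _ fun k hk =>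
        Equiv.swap_apply_of_ne_of_ne (fun h => by rw [h] at hk; omega) (fun h => by rw [h] at hk; omega),
        Function.comp_apply, Equiv.swap_apply_left]
      omega
  · -- `2 a_k ≥ c`: otherwise apply `τ_k : a_k ↦ c - a_k`
    intro k
    by_contra hcon
    rw [not_le] at hcon
    have hb := hS a ha (signFlipAt k) 1
    set b := (similitudeSignedPermEquiv (signFlipAt k) 1 (a, c)).1 with hbdef
    have hbk : b k = c - a k := by
      rw [hbdef, similitudeSignedPermEquiv_apply]; dsimp only
      rw [signFlipAt_self, if_neg (by decide), Equiv.Perm.coe_one, id]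
    have hbi : ∀ i, i ≠ k → b i = a i := fun i hik => by
      rw [hbdef, similitudeSignedPermEquiv_apply]; dsimp only
      rw [signFlipAt_of_ne hik, if_pos rfl, Equiv.Perm.coe_one, id]
    have heq : ∀ r : ℕ, r ≤ (k : ℕ) → headSum a r = headSum b r := fun r hr => by
      refine Finset.sum_congr rfl fun i _ => ?_
      split_ifs with hi
      · exact (hbi i fun h => by rw [h] at hi; omega).symm
      · rfl
    refine absurd (hmax _ hb) (not_le.2 (toLex_headSumVec_lt k heq ?_))
    rw [headSum_succ, headSum_succ, ← heq k le_rfl, hbk]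
    omega

/-! ## §2 Finitely many dominant exponents below a given one, in a multiplier slice -/

/-- **Finitely many dominant `λ = (μ, c)` (μ antitone, `2μ_i ≥ c`) with fixed `c` lie below `b` in the dominance order**
(`⌈c/2⌉ ≤ μ_i ≤ μ_0 ≤ b_0`). [cite: CartierCorvallis1979, §IV, proof of Thm. 4.1 (c)] -/
theorem finite_setOf_antitone_two_mul_ge_headSum_le (b : Fin n → ℤ) (c : ℤ) :
    Set.Finite {la : Fin n → ℤ | Antitone la ∧ (∀ i, c ≤ 2 * la i) ∧ ∀ r, headSum la r ≤ headSum b r} := by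
  rcases Nat.eq_zero_or_pos n with hn | hn
  · subst hn
    exact Set.Finite.subset (Set.finite_singleton (fun _ => 0)) fun la _ => funext fun i => i.elim0
  · set B := b ⟨0, hn⟩ with hB
    refine Set.Finite.subset (Set.Finite.pi fun _ : Fin n => Set.finite_Icc (-|c|) B) ?_
    rintro la ⟨hmono, hnn, hle⟩
    simp only [Set.mem_pi, Set.mem_univ, Set.mem_Icc, forall_true_left]
    have h0 : la ⟨0, hn⟩ ≤ B := by
      have h := hle 1
      rw [headSum_succ la ⟨0, hn⟩, headSum_succ b ⟨0, hn⟩, show ((⟨0, hn⟩ : Fin n) : ℕ) = 0 from rfl, headSum_zero,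
        headSum_zero, zero_add, zero_add] at h
      exact h
    refine fun i => ⟨?_, (hmono (Fin.le_iff_val_le_val.2 (Nat.zero_le _))).trans h0⟩
    have h1 := hnn i
    have h2 := neg_abs_le c
    have h3 := abs_nonneg c
    omega

variable {R : Type*} [CommRing R]

/-- `U(f)`: the dominant exponents `(μ, c)` lying below (same `c`, dominance order on `μ`) some dominant exponent of `supp f`.
[cite: CartierCorvallis1979, §IV, proof of Thm. 4.1 (c)] -/
def similitudeDominantBelow (f : AddMonoidAlgebra R ((Fin n → ℤ) × ℤ)) : Set ((Fin n → ℤ) × ℤ) :=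
  {lc | Antitone lc.1 ∧ (∀ i, lc.2 ≤ 2 * lc.1 i) ∧
    ∃ b : Fin n → ℤ, f.coeff (b, lc.2) ≠ 0 ∧ Antitone b ∧ ∀ r, headSum lc.1 r ≤ headSum b r}

/-- `U(f)` is finite. [cite: CartierCorvallis1979, §IV, proof of Thm. 4.1 (c)] -/
theorem finite_similitudeDominantBelow (f : AddMonoidAlgebra R ((Fin n → ℤ) × ℤ)) : (similitudeDominantBelow f).Finite := by
  refine Set.Finite.subset (Set.Finite.biUnion (Finset.finite_toSet f.coeff.support)
    fun bc _ => ((finite_setOf_antitone_two_mul_ge_headSum_le bc.1 bc.2).image fun la => (la, bc.2))) ?_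
  rintro ⟨la, c⟩ ⟨h1, h2, b, hb, -, hle⟩
  exact Set.mem_biUnion (Finsupp.mem_support_iff.2 hb) ⟨la, ⟨h1, h2, hle⟩, rfl⟩

/-! ## §3 Surjectivity onto `R[ℤⁿ × ℤ]^{W(GSp_{2n})}` and the Satake isomorphism -/

variable {K : Type*} [Field K] [Valued K ℤᵐ⁰] {ϖ : K} [NeZero n] [CompactSpace 𝒪[K]] [Finite 𝓀[K]]
  [IsHeckeTriple (⊤ : Submonoid (symplecticSimilitudeGroup (Fin n) K)) (symplecticSimilitudeInt (Fin n) K)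
    (symplecticSimilitudeInt (Fin n) K)]

/-- **SURJECTIVITY OF `𝒮_q` ONTO `R[ℤⁿ × ℤ]^{W(GSp_{2n})}`** (Andrianov–Zhuravlev Thm. 3.30 (3) «`Ω` is an isomorphism of `L^n_p`
with `ℚ[x_0^{±1}, …, x_n^{±1}]_W`», surjectivity half; Cartier Thm. 4.1, proof (c)) over any commutative `R` with `q ∈ Rˣ` the
residue cardinality: induction on `#U(f)`, subtracting `(f_{(a,c)} / q^{⟨ρ,a⟩}) 𝒮_q(T_{t(c, a - c·1)})` for a head-sum-maximal
(hence dominant) exponent `(a, c) ∈ supp f`. [cite: AndrianovZhuravlev1995, Ch. 3 §3.3 Thm. 3.30] [cite: CartierCorvallis1979, §IV Thm. 4.1 and its proof (c)]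
[cite: Satake1963, §7] -/
theorem exists_similitudeSatakeTransform_eq (hϖ : Valued.v ϖ = WithZero.exp (-1 : ℤ)) (q : Rˣ) (hq : (q : R) = Nat.card 𝓀[K])
    (f : AddMonoidAlgebra R ((Fin n → ℤ) × ℤ)) (hf : f ∈ weylInvariants R ((Fin n → ℤ) × ℤ) (similitudeWeylGroup n)) :
    ∃ T : heckeAlgebra R (symplecticSimilitudeGroup (Fin n) K) (symplecticSimilitudeInt (Fin n) K),
      similitudeSatakeTransform hϖ q T = f := by
  classical
  suffices H : ∀ (m : ℕ) (f : AddMonoidAlgebra R ((Fin n → ℤ) × ℤ)), f ∈ weylInvariants R ((Fin n → ℤ) × ℤ) (similitudeWeylGroup n) →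
      (finite_similitudeDominantBelow f).toFinset.card = m →
      ∃ T : heckeAlgebra R (symplecticSimilitudeGroup (Fin n) K) (symplecticSimilitudeInt (Fin n) K),
        similitudeSatakeTransform hϖ q T = f from
    H _ f hf rfl
  intro m
  induction m using Nat.strong_induction_on with
  | _ m ih =>
  intro f hf hm
  by_cases h0 : f = 0
  · exact ⟨0, by rw [h0, map_zero]⟩
  have hW := (mem_weylInvariants_similitudeWeylGroup_iff f).1 hf
  -- pick `(a, c) ∈ supp f`, then maximise the head-sum vector inside the slice `c`
  have hSne : f.coeff.support.Nonempty := by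
    rw [Finsupp.support_nonempty_iff, ne_eq, AddMonoidAlgebra.coeff_eq_zero]
    exact h0
  obtain ⟨⟨a₀, c⟩, ha₀⟩ := hSne
  set S : Finset (Fin n → ℤ) := (f.coeff.support.filter fun lc => lc.2 = c).image Prod.fst with hSdef
  have hmemS : ∀ μ, μ ∈ S ↔ f.coeff (μ, c) ≠ 0 := fun μ => by
    rw [hSdef, Finset.mem_image]
    constructor
    · rintro ⟨⟨μ', c'⟩, h, rfl⟩
      rw [Finset.mem_filter, Finsupp.mem_support_iff] at h
      obtain ⟨h1, rfl⟩ := h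
      exact h1
    · intro h
      exact ⟨(μ, c), Finset.mem_filter.2 ⟨Finsupp.mem_support_iff.2 h, rfl⟩, rfl⟩
  have hSne' : S.Nonempty := ⟨a₀, (hmemS a₀).2 (Finsupp.mem_support_iff.1 ha₀)⟩
  obtain ⟨a, haS, hmax⟩ := S.exists_max_image (fun μ => toLex (headSumVec μ)) hSne'
  have haS' : f.coeff (a, c) ≠ 0 := (hmemS a).1 haS
  have hstab : ∀ μ ∈ S, ∀ (ε : Fin n → ℤˣ) (π : Equiv.Perm (Fin n)), (similitudeSignedPermEquiv ε π (μ, c)).1 ∈ S :=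
    fun μ hμ ε π => by
      rw [hmemS] at hμ ⊢
      have h := hW ε π (μ, c)
      rw [show similitudeSignedPermEquiv ε π (μ, c) = ((similitudeSignedPermEquiv ε π (μ, c)).1, c) from Prod.ext rfl rfl] at h
      rwa [h]
  obtain ⟨hmono, hdom⟩ := antitone_two_mul_ge_of_isMaxOn_headSumVec hstab haS hmax
  -- the Cartan operator `T_{t(c, a - c·1)}` and its transform `F = q^{⟨ρ,a⟩} x^{(a,c)} + lower terms`
  set a' : Fin n → ℤ := fun i => a i - c with ha'
  have hmono' : Antitone a' := fun i j hij => sub_le_sub_right (hmono hij) _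
  have hdom' : ∀ i, 0 ≤ c + 2 * a' i := fun i => by have := hdom i; rw [ha']; dsimp only; linarith
  have haa' : (fun i => c + a' i) = a := funext fun i => by rw [ha']; dsimp only; ring
  set Ta : heckeAlgebra R (symplecticSimilitudeGroup (Fin n) K) (symplecticSimilitudeInt (Fin n) K) :=
    heckeAlgebra.doubleCosetOperator (symplecticSimilitudeInt (Fin n) K)
      (similitudeTorusElt (uniformizer_ne_zero hϖ) c a' : symplecticSimilitudeGroup (Fin n) K) with hTa
  set F := similitudeSatakeTransform hϖ q Ta with hFdef
  have hcF : F.coeff (a, c) = ((q ^ symplecticRhoPairing a : Rˣ) : R) := by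
    have h := coeff_self_similitudeSatakeTransform_torusElt hϖ q hmono' hdom'
    rw [haa'] at h
    exact h
  have hsnd : ∀ μc : (Fin n → ℤ) × ℤ, F.coeff μc ≠ 0 → μc.2 = c := fun μc hμ =>
    snd_eq_of_coeff_similitudeSatakeTransform_ne_zero hϖ q c a' hμ
  have htri : ∀ μc : (Fin n → ℤ) × ℤ, F.coeff μc ≠ 0 → ∀ r, headSum μc.1 r ≤ headSum a r := fun μc hμ r => by
    have h := headSum_le_of_coeff_similitudeSatakeTransform_ne_zero hϖ q hmono' hdom' hμ r
    rw [headSum_eq, headSum_eq]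
    refine h.trans (le_of_eq (Finset.sum_congr rfl fun i _ => ?_))
    rw [← haa']
  have hF : F ∈ weylInvariants R ((Fin n → ℤ) × ℤ) (similitudeWeylGroup n) := similitudeSatakeTransform_mem_weylInvariants hϖ q hq Ta
  -- `g = f - (f_{(a,c)} / q^{⟨ρ,a⟩}) F`
  set k : R := f.coeff (a, c) * (((q ^ symplecticRhoPairing a)⁻¹ : Rˣ) : R) with hk
  set g := f - k • F with hgdef
  have hg : g ∈ weylInvariants R ((Fin n → ℤ) × ℤ) (similitudeWeylGroup n) := Subalgebra.sub_mem _ hf (Subalgebra.smul_mem _ hF k)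
  have hgcoeff : ∀ μc, g.coeff μc = f.coeff μc - k * F.coeff μc := fun μc => by
    rw [hgdef, AddMonoidAlgebra.coeff_sub, AddMonoidAlgebra.coeff_smul, Finsupp.sub_apply, Finsupp.smul_apply, smul_eq_mul]
  have hga : g.coeff (a, c) = 0 := by rw [hgcoeff, hk, hcF, mul_assoc, Units.inv_mul, mul_one, sub_self]
  have hgsupp : ∀ μc, g.coeff μc ≠ 0 → f.coeff μc ≠ 0 ∨ F.coeff μc ≠ 0 := fun μc h => by
    by_contra h'
    rw [not_or, not_ne_iff, not_ne_iff] at h'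
    exact h (by rw [hgcoeff, h'.1, h'.2, mul_zero, sub_zero])
  -- `U(g) ⊊ U(f)`
  have hsub : similitudeDominantBelow g ⊆ similitudeDominantBelow f := by
    rintro ⟨la, c'⟩ ⟨h1, h2, b, hb, hbm, hle⟩
    rcases hgsupp (b, c') hb with hbf | hbF
    · exact ⟨h1, h2, b, hbf, hbm, hle⟩
    · have hc' : c' = c := hsnd (b, c') hbF
      subst hc'
      exact ⟨h1, h2, a, haS', hmono, fun r => (hle r).trans (htri (b, c') hbF r)⟩
  have haU : (a, c) ∈ similitudeDominantBelow f := ⟨hmono, hdom, a, haS', hmono, fun _ => le_rfl⟩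
  have haU' : (a, c) ∉ similitudeDominantBelow g := by
    rintro ⟨-, -, b, hb, -, hle⟩
    have hba : a = b := by
      rcases hgsupp (b, c) hb with hbf | hbF
      · exact eq_of_headSum_le_of_toLex_le hle (hmax b ((hmemS b).2 hbf))
      · exact eq_of_headSum_le_antisymm hle (htri (b, c) hbF)
    rw [← hba] at hb
    exact hb hga
  have hlt : (finite_similitudeDominantBelow g).toFinset.card < (finite_similitudeDominantBelow f).toFinset.card :=
    Finset.card_lt_card (Set.Finite.toFinset_ssubset_toFinset.2 ((Set.ssubset_iff_of_subset hsub).2 ⟨(a, c), haU, haU'⟩))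
  obtain ⟨T', hT'⟩ := ih _ (hm ▸ hlt) g hg rfl
  refine ⟨T' + k • Ta, ?_⟩
  rw [map_add, map_smul, hT', hgdef, sub_add_cancel]

/-- **`range 𝒮_q = R[ℤⁿ × ℤ]^{W(GSp_{2n})}`** (A–Z Thm. 3.30 (3) over any commutative `R` with `q ∈ Rˣ` the residue cardinality).
[cite: AndrianovZhuravlev1995, Ch. 3 §3.3 Thm. 3.30] [cite: CartierCorvallis1979, §IV Thm. 4.1] -/
theorem range_similitudeSatakeTransform_eq_weylInvariants (hϖ : Valued.v ϖ = WithZero.exp (-1 : ℤ)) (q : Rˣ)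
    (hq : (q : R) = Nat.card 𝓀[K]) :
    (similitudeSatakeTransform (n := n) (K := K) hϖ q).range = weylInvariants R ((Fin n → ℤ) × ℤ) (similitudeWeylGroup n) :=
  le_antisymm (range_similitudeSatakeTransform_le_weylInvariants hϖ q hq) fun f hf =>
    (AlgHom.mem_range _).2 (exists_similitudeSatakeTransform_eq hϖ q hq f hf)

/-- **THE SATAKE ISOMORPHISM FOR `GSp_{2n}` IN EVERY RANK, OVER EVERY COMMUTATIVE RING `R` WITH `q ∈ Rˣ`**:
`𝒮_q : ℋ_R(GSp_{2n}(K), GSp_{2n}(𝒪)) ⥲ R[ℤⁿ × ℤ]^{W(GSp_{2n})}` — Andrianov–Zhuravlev's Theorem 3.30 (3) («the restriction of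
`Ω` to `L^n_p` is an isomorphism with `ℚ[x_0^{±1}, …, x_n^{±1}]_W`») and Cartier's Theorem 4.1 for `G = GSp_{2n}`, with
`(q : R) = #𝓀` a unit (e.g. `R = ℤ[1/q]`, `𝔽_ℓ` (`ℓ ∤ q`), `ℚ`, `ℂ`). [cite: AndrianovZhuravlev1995, Ch. 3 §3.3 Thm. 3.30]
[cite: CartierCorvallis1979, §IV Thm. 4.1] [cite: Satake1963, §7] -/
def similitudeSatakeAlgEquiv (hϖ : Valued.v ϖ = WithZero.exp (-1 : ℤ)) (q : Rˣ) (hq : (q : R) = Nat.card 𝓀[K]) :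
    heckeAlgebra R (symplecticSimilitudeGroup (Fin n) K) (symplecticSimilitudeInt (Fin n) K) ≃ₐ[R]
      weylInvariants R ((Fin n → ℤ) × ℤ) (similitudeWeylGroup n) :=
  AlgEquiv.ofBijective
    ((similitudeSatakeTransform hϖ q).codRestrict (weylInvariants R ((Fin n → ℤ) × ℤ) (similitudeWeylGroup n))
      fun T => similitudeSatakeTransform_mem_weylInvariants hϖ q hq T)
    ⟨fun T T' h => similitudeSatakeTransform_injective_of_commRing hϖ q (congrArg Subtype.val h),
      fun f => by
        obtain ⟨T, hT⟩ := exists_similitudeSatakeTransform_eq hϖ q hq f.1 f.2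
        exact ⟨T, Subtype.ext hT⟩⟩

/-- The Satake isomorphism is the Satake transform. [cite: AndrianovZhuravlev1995, Ch. 3 §3.3 Thm. 3.30] [cite: CartierCorvallis1979, §IV Thm. 4.1] -/
@[simp] theorem coe_similitudeSatakeAlgEquiv (hϖ : Valued.v ϖ = WithZero.exp (-1 : ℤ)) (q : Rˣ) (hq : (q : R) = Nat.card 𝓀[K])
    (T : heckeAlgebra R (symplecticSimilitudeGroup (Fin n) K) (symplecticSimilitudeInt (Fin n) K)) :
    ((similitudeSatakeAlgEquiv hϖ q hq T : weylInvariants R ((Fin n → ℤ) × ℤ) (similitudeWeylGroup n)) :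
        AddMonoidAlgebra R ((Fin n → ℤ) × ℤ)) = similitudeSatakeTransform hϖ q T := rfl

/-- The inverse isomorphism undoes the transform: `𝒮_q⁻¹(𝒮_q T) = T`. [cite: CartierCorvallis1979, §IV Thm. 4.1] -/
theorem similitudeSatakeAlgEquiv_symm_apply_similitudeSatakeTransform (hϖ : Valued.v ϖ = WithZero.exp (-1 : ℤ)) (q : Rˣ)
    (hq : (q : R) = Nat.card 𝓀[K]) (T : heckeAlgebra R (symplecticSimilitudeGroup (Fin n) K) (symplecticSimilitudeInt (Fin n) K)) :
    (similitudeSatakeAlgEquiv hϖ q hq).symm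
        ⟨similitudeSatakeTransform hϖ q T, similitudeSatakeTransform_mem_weylInvariants hϖ q hq T⟩ = T :=
  (similitudeSatakeAlgEquiv hϖ q hq).symm_apply_eq.2 (Subtype.ext (coe_similitudeSatakeAlgEquiv hϖ q hq T).symm)

/-- **A `W(GSp_{2n})`-invariant Laurent polynomial is the transform of a UNIQUE Hecke operator.**
[cite: AndrianovZhuravlev1995, Ch. 3 §3.3 Thm. 3.30, (3.77)] -/
theorem existsUnique_similitudeSatakeTransform_eq (hϖ : Valued.v ϖ = WithZero.exp (-1 : ℤ)) (q : Rˣ)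
    (hq : (q : R) = Nat.card 𝓀[K]) (f : AddMonoidAlgebra R ((Fin n → ℤ) × ℤ))
    (hf : f ∈ weylInvariants R ((Fin n → ℤ) × ℤ) (similitudeWeylGroup n)) :
    ∃! T : heckeAlgebra R (symplecticSimilitudeGroup (Fin n) K) (symplecticSimilitudeInt (Fin n) K),
      similitudeSatakeTransform hϖ q T = f := by
  obtain ⟨T, hT⟩ := exists_similitudeSatakeTransform_eq hϖ q hq f hf
  exact ⟨T, hT, fun T' hT' => similitudeSatakeTransform_injective_of_commRing hϖ q (hT'.trans hT.symm)⟩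

end Literature.NumberTheory.Automorphic.SymplecticCartan

end
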